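import Literature.NumberTheory.EllipticCurves.ZpExtensionEisensteinTwistRestrictedDualityInstanceProofs
import Literature.NumberTheory.EllipticCurves.TorsionFilAtCountMultiplicativeThreeProofs
import HarnessLib

/-!
# Howard's Lemma 3.1.1 at the `E`-level and the perfect restricted duality form at a place `v ∣ 3` of MULTIPLICATIVE reduction
# (theorems only — no definition, no named fact, no instance, no `sorry`)

Topic `NumberTheory/EllipticCurves` (LEAD `bsd-wall-utd-p1`, crux r205 stmt-BirchSwinnertonDyer-24737 `TwinAlgMuZeroAtThree`,
line `beta-road`, stub `stub_howardOutputsOfFamily`, E2 assembly at `v ∣ 3`).  Cell x9/x10b's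
`TorsionFilAtConjugatePairingProofs.conjPairing_torsionFilAt_clauses` ((E-orth), (E-R), (E-S) for `ẽ_j = log e_j(·, τ_* ·)` on
`A = Fil_v E_K[p^j]`, `A′ = δ_v Fil_{σv} E_K[p^j]`) and
`ZpExtensionEisensteinTwistRestrictedDualityInstanceProofs.eisensteinDualityForm_torsionFilAt_restricted_perfect` (the restricted
duality form of the Eisenstein level is perfect, Howard's Lemma 3.1.1) assume GOOD reduction with an ordinary point at `v ∋ p`, used
only through `pairing_torsionFilAt_eq_zero` (isotropy) and `natCard_torsionFilAt_mul_self` (`#Fil² = #E[p^j]`).  At `p = 3` both hold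
at places of MULTIPLICATIVE reduction (`TorsionFilAtCyclicMultiplicativeThreeProofs`, `TorsionFilAtCountMultiplicativeThreeProofs`):

* `natCard_torsionFilAt_mul_self_of_hasMultiplicativeReductionAt_three` — `#Fil_v E[3^k] · #Fil_v E[3^k] = #E[3^k]`;
* `conjPairing_torsionFilAt_clauses_of_hasMultiplicativeReductionAt_three`,
  `eisensteinDualityForm_torsionFilAt_restricted_perfect_of_hasMultiplicativeReductionAt_three` — x9's two statements at
  multiplicative `v ∣ 3` (proofs verbatim with the two inputs replaced); the `hordW : IsOrdinaryAt W p` input of x9's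
  `…RestrictedPairing{,Flip}Proofs` / `…H4AnnSatOfLiftsProofs` is thereby replaced for the twin (`IsOrdinaryAt` = good ordinary,
  false at `3 ∥ N′`).
BSD is not proved by any of this.

References: [Howard2004HeegnerKolyvagin] Rem. 1.3.2, Lemma 2.1.1, §1.3 H.4, §3.1, Lemma 3.1.1; [GreenbergLNM1716] §2 (pp. 82–83);
[SilvermanAEC2009] III.8.1, VII.2, Thm. C.14.1.
-/

noncomputable section

open Function NumberField IsDedekindDomain Field

namespace WeierstrassCurve

open Literature.NumberTheory.EllipticCurves Literature.NumberTheory.GaloisRepresentations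
open Literature.NumberTheory.GaloisCohomology.Howard2004 Literature.NumberTheory.EllipticCurves.IwasawaAlgebra
open Literature.NumberTheory.EllipticCurves.ZpExtension AddSubgroup

section Card

variable {K : Type} [Field K] [NumberField K] (W : WeierstrassCurve K) [W.IsElliptic] (v : HeightOneSpectrum (𝓞 K))

/-- **`#Fil_v E[3^k] · #Fil_v E[3^k] = #E[3^k]`** at a place `v ∋ 3` of multiplicative reduction (`#Fil_v E[3^k] = 3^k`,
`#E[3^k] = 3^{2k}`) — x9's `natCard_torsionFilAt_mul_self`, multiplicative places.
[cite: GreenbergLNM1716, §2 (pp. 82–83)] [cite: SilvermanAEC2009, Cor. III.6.4 and Thm. C.14.1] -/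
theorem natCard_torsionFilAt_mul_self_of_hasMultiplicativeReductionAt_three (h3v : ((3 : ℕ) : 𝓞 K) ∈ v.asIdeal)
    (hmult : W.HasMultiplicativeReductionAt v) (k : ℕ) :
    Nat.card (W.torsionFilAt v (((3 : ℕ) : ℤ) ^ k)) * Nat.card (W.torsionFilAt v (((3 : ℕ) : ℤ) ^ k)) =
      Nat.card (geomTorsion W (((3 : ℕ) : ℤ) ^ k)) := by
  have h3K : ((3 : ℕ) : K) ≠ 0 := by exact_mod_cast (three_ne_zero : (3 : K) ≠ 0)
  have hE : Nat.card (geomTorsion W (((3 : ℕ) : ℤ) ^ k)) = 3 ^ (2 * k) := by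
    rw [Nat.card_congr (W.geomTorsionPowCongr 3 k).toEquiv]
    exact W.card_geomTorsion_pow_eq 3 (card_torsionPoints_eq_sq_holds W (AlgebraicClosure K)) h3K k
  rw [W.natCard_torsionFilAt_pow_eq_of_hasMultiplicativeReductionAt_three v h3v hmult k, hE, two_mul, pow_add]

end Card

variable {K : Type} [Field K] [NumberField K] (W : WeierstrassCurve ℚ) [W.IsElliptic] {m : ℕ} (hm : 1 ≤ m)
  (σ : K ≃ₐ[ℚ] K) (hσ₁ : σ ≠ 1) (hσ : σ * σ = 1) (τ : AlgebraicClosure K ≃+* AlgebraicClosure K)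
  (hτ : IsLiftOfAut σ τ) (hτ₂ : Function.Involutive τ)

omit hm in
/-- **Howard's Lemma 3.1.1 at the `E`-level for `ẽ_j = log e_j(·, τ_* ·)` at a place `v ∋ 3` of MULTIPLICATIVE reduction** (x9's
`conjPairing_torsionFilAt_clauses`, multiplicative places): (E-orth), (E-R), (E-S) for `A = Fil_v E_K[3^j]`, `A′ = δ_v · Fil_{σv} E_K[3^j]`.
[cite: Howard2004HeegnerKolyvagin, Rem. 1.3.2, §3.1 and Lemma 3.1.1 (arXiv:1202.6340 p. 7 L81–88, p. 15 L56–62)]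
[cite: GreenbergLNM1716, §2 (pp. 82–83)] [cite: SilvermanAEC2009, III.8.1 and VII.2 Props. 2.1–2.2] -/
theorem conjPairing_torsionFilAt_clauses_of_hasMultiplicativeReductionAt_three (v : HeightOneSpectrum (𝓞 K))
    (hmult : (W.baseChange K).HasMultiplicativeReductionAt v) (hpv : ((3 : ℕ) : 𝓞 K) ∈ v.asIdeal)
    (j : ℕ) (e : geomTorsion (W.baseChange K) (((3 : ℕ) : ℤ) ^ j) →+ geomTorsion (W.baseChange K) (((3 : ℕ) : ℤ) ^ j) →+
      DiscreteGaloisModule.MuCarrier K (3 ^ j))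
    (log : DiscreteGaloisModule.MuCarrier K (3 ^ j) →+ ZMod (3 ^ j)) (hlog : Injective log)
    (halt : ∀ a, e a a = 0) (hnd : ∀ b, (∀ a, e a b = 0) → b = 0)
    (hθθ : ∀ a : geomTorsion (W.baseChange K) (((3 : ℕ) : ℤ) ^ j), hτ.torsionMap W _ (hτ.torsionMap W _ a) = a) :
    let eb := conjPairing e (hτ.torsionMap W (((3 : ℕ) : ℤ) ^ j)) log
    let A := (W.baseChange K).torsionFilAt v (((3 : ℕ) : ℤ) ^ j)
    let A' := ((W.baseChange K).torsionFilAt (σ • v) (((3 : ℕ) : ℤ) ^ j)).map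
      ((W.baseChange K).torsionGaloisModule (((3 : ℕ) : ℤ) ^ j) ((ConjugationDatum.ofLifts σ hσ₁ hσ τ hτ hτ₂).δ v))
    (∀ a ∈ A, ∀ b ∈ A', eb a b = 0) ∧ (∀ b, (∀ a ∈ A, eb a b = 0) → b ∈ A') ∧
      (∀ φ : A →+ ZMod (3 ^ j), ∃ b, ∀ a : A, eb (a : geomTorsion (W.baseChange K) (((3 : ℕ) : ℤ) ^ j)) b = φ a) := by
  intro eb A A'
  haveI : NeZero (3 ^ j) := ⟨pow_ne_zero j Nat.prime_three.ne_zero⟩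
  have hn : (((3 : ℕ) : ℤ) ^ j) ≠ 0 := pow_ne_zero j (Nat.cast_ne_zero.mpr Nat.prime_three.ne_zero)
  haveI : Finite (geomTorsion (W.baseChange K) (((3 : ℕ) : ℤ) ^ j)) :=
    finite_torsionPoints_holds (W.baseChange K) (AlgebraicClosure K) hn
  haveI : CharZero ((σ • v).adicCompletion K) := charZero_of_injective_algebraMap (algebraMap K _).injective
  haveI : CharZero (v.adicCompletion K) := charZero_of_injective_algebraMap (algebraMap K _).injective
  set θ := hτ.torsionMap W (((3 : ℕ) : ℤ) ^ j) with hθdef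
  set δ := (W.baseChange K).torsionGaloisModule (((3 : ℕ) : ℤ) ^ j) ((ConjugationDatum.ofLifts σ hσ₁ hσ τ hτ hτ₂).δ v) with hδ
  -- the inputs of the generic statement
  have hM : ∀ x : geomTorsion (W.baseChange K) (((3 : ℕ) : ℤ) ^ j), (3 ^ j) • x = 0 := fun x ↦ Subtype.ext (by
    rw [AddSubgroupClass.coe_nsmul, ZeroMemClass.coe_zero, ← natCast_zsmul, Nat.cast_pow]
    exact (Submodule.mem_torsionBy_iff _ _).mp x.2)
  have hiso : ∀ a ∈ A, ∀ a' ∈ A, e a a' = 0 :=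
    (W.baseChange K).pairing_torsionFilAt_eq_zero_of_hasMultiplicativeReductionAt_three v hpv hmult j e halt
  have hcard : Nat.card A * Nat.card A = Nat.card (geomTorsion (W.baseChange K) (((3 : ℕ) : ℤ) ^ j)) :=
    (W.baseChange K).natCard_torsionFilAt_mul_self_of_hasMultiplicativeReductionAt_three v hpv hmult j
  have hθA : ∀ x ∈ A', θ x ∈ A := by
    intro x hx
    obtain ⟨a', ha', rfl⟩ := Submodule.mem_map.mp hx
    exact W.torsionMap_delta_apply_mem_torsionFilAt σ hσ₁ hσ τ hτ hτ₂ v _ ha'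
  have hθA' : ∀ y ∈ A, ∃ x ∈ A', θ x = y := by
    intro y hy
    obtain ⟨a', ha', h⟩ := W.exists_torsionMap_delta_apply_eq_of_mem_torsionFilAt σ hσ₁ hσ τ hτ hτ₂ v hn hy
    exact ⟨δ a', Submodule.mem_map.mpr ⟨a', ha', rfl⟩, h⟩
  exact conjPairing_restricted_clauses e θ log hlog hM hnd hθθ A A' hiso hcard hθA hθA'

/-- **The restricted duality form of the curve's Eisenstein level `j` is perfect at a place `v ∋ 3` of MULTIPLICATIVE reduction**
(x9's `eisensteinDualityForm_torsionFilAt_restricted_perfect`, multiplicative places; replaces the `IsOrdinaryAt W p` discharge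
`…_of_isOrdinaryAt` for the twin): (horth), (hR), (hS) for `V = A ⊗ Fil_v E[3^j]`, `V′ = A ⊗ δ_v·Fil_{σv} E[3^j]`.
[cite: Howard2004HeegnerKolyvagin, Lemma 2.1.1, §1.3 H.4 and Lemma 3.1.1 (arXiv:1202.6340 p. 7 L69–88, p. 15 L56–62)]
[cite: GreenbergLNM1716, §2 (pp. 82–83)] [cite: SilvermanAEC2009, III.8.1] -/
theorem eisensteinDualityForm_torsionFilAt_restricted_perfect_of_hasMultiplicativeReductionAt_three (v : HeightOneSpectrum (𝓞 K))
    (hmult : (W.baseChange K).HasMultiplicativeReductionAt v) (hpv : ((3 : ℕ) : 𝓞 K) ∈ v.asIdeal)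
    (j : ℕ) (e : geomTorsion (W.baseChange K) (((3 : ℕ) : ℤ) ^ j) →+ geomTorsion (W.baseChange K) (((3 : ℕ) : ℤ) ^ j) →+
      DiscreteGaloisModule.MuCarrier K (3 ^ j))
    (log : DiscreteGaloisModule.MuCarrier K (3 ^ j) →+ ZMod (3 ^ j)) (hlog : Injective log)
    (halt : ∀ a, e a a = 0) (hnd : ∀ b, (∀ a, e a b = 0) → b = 0)
    (hθθ : ∀ a : geomTorsion (W.baseChange K) (((3 : ℕ) : ℤ) ^ j), hτ.torsionMap W _ (hτ.torsionMap W _ a) = a) :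
    let eb := conjPairing e (hτ.torsionMap W (((3 : ℕ) : ℤ) ^ j)) log
    let V : Submodule ℤ (EisensteinCoeff.Twisted 3 m j (geomTorsion (W.baseChange K) (((3 : ℕ) : ℤ) ^ j))) :=
      Submodule.span ℤ {x | ∃ (c : EisensteinCoeff 3 m j) (a : geomTorsion (W.baseChange K) (((3 : ℕ) : ℤ) ^ j)),
        a ∈ (W.baseChange K).torsionFilAt v (((3 : ℕ) : ℤ) ^ j) ∧ x = EisensteinCoeff.Twisted.tmul c a}
    let V' : Submodule ℤ (EisensteinCoeff.Twisted 3 m j (geomTorsion (W.baseChange K) (((3 : ℕ) : ℤ) ^ j))) :=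
      Submodule.span ℤ {x | ∃ (c : EisensteinCoeff 3 m j) (b : geomTorsion (W.baseChange K) (((3 : ℕ) : ℤ) ^ j)),
        b ∈ ((W.baseChange K).torsionFilAt (σ • v) (((3 : ℕ) : ℤ) ^ j)).map
          ((W.baseChange K).torsionGaloisModule (((3 : ℕ) : ℤ) ^ j) ((ConjugationDatum.ofLifts σ hσ₁ hσ τ hτ hτ₂).δ v)) ∧
        x = EisensteinCoeff.Twisted.tmul c b}
    (∀ s ∈ V, ∀ t ∈ V', eisensteinDualityForm hm j eb s t = 0) ∧
      (∀ t, (∀ s ∈ V, EisensteinCoeff.tailFormZMod 3 hm j (eisensteinDualityForm hm j eb s t) = 0) → t ∈ V') ∧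
      (∀ φ : V →+ ZMod (3 ^ j), ∃ t, ∀ s : V,
        EisensteinCoeff.tailFormZMod 3 hm j (eisensteinDualityForm hm j eb (s : _) t) = φ s) := by
  intro eb V V'
  obtain ⟨horth, hR, hS⟩ := W.conjPairing_torsionFilAt_clauses_of_hasMultiplicativeReductionAt_three σ hσ₁ hσ τ hτ hτ₂ v hmult hpv j e log hlog halt hnd hθθ
  refine ⟨fun s hs t ht ↦ ?_, fun t ht ↦ ?_, fun φ ↦ ?_⟩
  · exact eisensteinDualityForm_eq_zero_of_mem_span_tmul hm j eb _ _ horth hs ht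
  · exact mem_span_tmul_of_forall_tailFormZMod_eisensteinDualityForm_eq_zero hm j eb _ _ hR t ht
  · obtain ⟨t, ht⟩ := exists_forall_tailFormZMod_eisensteinDualityForm_eq_of_mem_span_tmul hm j eb _ hS φ
    exact ⟨t, fun s ↦ ht s s.2⟩

end WeierstrassCurve

end
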